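import Mathlib
import Summits.Ventures.PercRepro.TriangleCapZoneRows

/-!
# PercRepro — THE NARROW REGIME ONE BELOW THE THRESHOLD: THE ARITHMETIC OF THE WINDOW (p3, gen 56; part 332)

For the window `r < I ≤ D − r` (`d = I − r`, `σ = 2 r + d ≤ D`) one below the threshold (`m = D + r − 2`), with
`g(r − 1) = 2 r (D − r) − 2 (r − 1)(r − 2)`: (A) when the column-loss lemma applies (at most `m` active rows) the
deficiency is at least `2 I + φ_D(σ) + 2 σ − 2 + φ_D(D − d)` — above `g(r − 1)` by `2 (D − 2 r) + 2 d + 2 + 2 (d − 1)(D − 2 r − d)`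
(`window_arith_A`; at `σ = D` the column loss is `2 (D − 1)`: `window_arith_A_top`); (B) otherwise the `P ≥ j + 2`
partial rows of sum `(j + 1) D − d` cost at least `P (D − 1) + φ_{D−2}((j + 1) D − d − P)` (part 331), which is
nondecreasing in `P` (`uniform_row_mono`: `φ_M(x) ≤ φ_M(x − 1) + (M − 1)`) and at `P = j + 2` is at least
`(d − e + 2)(D − 1) + (D − 2 − e) e` with `e = d − j` when `j < d`, so that the deficiency exceeds `g(r − 1)` by
`d (2 (D − 2 r) − d + 1) − e (e + 1) + 2 (D − 2 r + 1) ≥ 2` (`window_arith_B`).  Axioms: standard.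
-/

namespace PercRepro

namespace TriangleCap

namespace C047

open Finset

/-- `φ_M(x) ≤ φ_M(x − 1) + (M − 1)` for `1 ≤ x`, `1 ≤ M`. -/
theorem phi_step (M x : ℕ) (hM : 1 ≤ M) (hx : 1 ≤ x) : phiD M x ≤ phiD M (x - 1) + (M - 1) := by
  obtain ⟨y, hy⟩ : ∃ y, x % M = y := ⟨_, rfl⟩
  have hyM : y < M := by rw [← hy]; exact Nat.mod_lt x (by omega)
  have hdiv := Nat.div_add_mod x M
  rw [hy] at hdiv
  rcases Nat.eq_zero_or_pos y with rfl | hy1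
  · unfold phiD
    rw [hy, zero_mul]
    exact Nat.zero_le _
  · have e : x - 1 = M * (x / M) + (y - 1) := by omega
    unfold phiD
    rw [hy, e, Nat.mul_add_mod, Nat.mod_eq_of_lt (by omega : y - 1 < M)]
    obtain ⟨y', rfl⟩ : ∃ y', y = y' + 1 := ⟨y - 1, by omega⟩
    have e1 : y' + 1 - 1 = y' := by omega
    rw [e1]
    obtain ⟨u, rfl⟩ : ∃ u, M = y' + 1 + u := ⟨M - y' - 1, by omega⟩
    have e2 : y' + 1 + u - (y' + 1) = u := by omega
    have e3 : y' + 1 + u - y' = u + 1 := by omega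
    have e4 : y' + 1 + u - 1 = y' + u := by omega
    rw [e2, e3, e4]
    nlinarith

/-- **THE UNIFORM ROW BOUND IS NONDECREASING IN `P`:** for `P₀ ≤ P ≤ S`,
`P₀ (D − 1) + φ_{D−2}(S − P₀) ≤ P (D − 1) + φ_{D−2}(S − P)`. -/
theorem uniform_row_mono (D S P₀ P : ℕ) (hD : 3 ≤ D) (hP₀ : P₀ ≤ P) (hPS : P ≤ S) :
    P₀ * (D - 1) + phiD (D - 2) (S - P₀) ≤ P * (D - 1) + phiD (D - 2) (S - P) := by
  induction P with
  | zero =>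
    have : P₀ = 0 := by omega
    subst this
    exact le_refl _
  | succ P ih =>
    rcases Nat.lt_or_ge P₀ (P + 1) with hlt | hge
    · have h1 := ih (by omega) (by omega)
      have h2 := phi_step (D - 2) (S - P) (by omega) (by omega)
      have e : S - P - 1 = S - (P + 1) := by omega
      rw [e] at h2
      have e2 : (P + 1) * (D - 1) = P * (D - 1) + (D - 1) := by ring
      rw [e2]
      omega
    · have : P₀ = P + 1 := by omega
      subst this
      exact le_refl _

/-- **(A) THE COLUMN-LOSS BRANCH, `σ = 2 r + d ≤ D − 1`:**
`2 r (D − r) ≤ 2 (r + d) + (σ (D − σ) + (2 σ − 2)) + (D − d) d + 2 (r − 1)(r − 2)`. -/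
theorem window_arith_A (D r d : ℕ) (hr : 2 ≤ r) (hd : 1 ≤ d) (hσ : 2 * r + d + 1 ≤ D) :
    2 * (r * (D - r)) ≤ 2 * (r + d) + ((2 * r + d) * (D - (2 * r + d)) + (2 * (2 * r + d) - 2)) + (D - d) * d +
      2 * ((r - 1) * (r - 2)) := by
  obtain ⟨u, rfl⟩ : ∃ u, D = 2 * r + d + 1 + u := ⟨D - (2 * r + d + 1), by omega⟩
  obtain ⟨r', rfl⟩ : ∃ r', r = r' + 2 := ⟨r - 2, by omega⟩
  have e1 : 2 * (r' + 2) + d + 1 + u - (r' + 2) = r' + 2 + d + 1 + u := by omega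
  have e2 : 2 * (r' + 2) + d + 1 + u - (2 * (r' + 2) + d) = 1 + u := by omega
  have e3 : 2 * (2 * (r' + 2) + d) - 2 = 2 * (2 * r' + d) + 6 := by omega
  have e4 : 2 * (r' + 2) + d + 1 + u - d = 2 * (r' + 2) + 1 + u := by omega
  have e5 : r' + 2 - 1 = r' + 1 := by omega
  have e6 : r' + 2 - 2 = r' := by omega
  rw [e1, e2, e3, e4, e5, e6]
  nlinarith

/-- **(A') THE COLUMN-LOSS BRANCH AT `σ = D` (`I = D − r`):**
`2 r (D − r) ≤ 2 (D − r) + 2 (D − 1) + 2 r (D − 2 r) + 2 (r − 1)(r − 2)`. -/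
theorem window_arith_A_top (D r : ℕ) (hr : 2 ≤ r) (h2 : 2 * r + 1 ≤ D) :
    2 * (r * (D - r)) ≤ 2 * (D - r) + 2 * (D - 1) + 2 * r * (D - 2 * r) + 2 * ((r - 1) * (r - 2)) := by
  obtain ⟨u, rfl⟩ : ∃ u, D = 2 * r + 1 + u := ⟨D - (2 * r + 1), by omega⟩
  obtain ⟨r', rfl⟩ : ∃ r', r = r' + 2 := ⟨r - 2, by omega⟩
  have e1 : 2 * (r' + 2) + 1 + u - (r' + 2) = r' + 2 + 1 + u := by omega
  have e2 : 2 * (r' + 2) + 1 + u - 1 = 2 * (r' + 2) + u := by omega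
  have e3 : 2 * (r' + 2) + 1 + u - 2 * (r' + 2) = 1 + u := by omega
  have e4 : r' + 2 - 1 = r' + 1 := by omega
  have e5 : r' + 2 - 2 = r' := by omega
  rw [e1, e2, e3, e4, e5]
  nlinarith

/-- **(B) THE ROW BRANCH AT `P = j + 2`, `j ≤ d`:** with `e = d − j`,
`2 r (D − r) ≤ 2 (r + d) + (2 r + d) (D − (2 r + d)) + (d − e + 2)(D − 1) + (D − (e + 2)) e + 2 (r − 1)(r − 2)`. -/
theorem window_arith_B (D r d e : ℕ) (hr : 2 ≤ r) (hd : 2 * r + d ≤ D) (hed : e ≤ d) :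
    2 * (r * (D - r)) ≤ 2 * (r + d) + (2 * r + d) * (D - (2 * r + d)) + (d - e + 2) * (D - 1) +
      (D - (e + 2)) * e + 2 * ((r - 1) * (r - 2)) := by
  obtain ⟨u, hu⟩ : ∃ u, D = 2 * r + d + u := ⟨D - (2 * r + d), by omega⟩
  obtain ⟨f, hf⟩ : ∃ f, d = e + f := ⟨d - e, by omega⟩
  obtain ⟨r', hr'⟩ : ∃ r', r = r' + 2 := ⟨r - 2, by omega⟩
  subst hu hf hr'
  have e1 : 2 * (r' + 2) + (e + f) + u - (r' + 2) = r' + 2 + (e + f) + u := by omega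
  have e2 : 2 * (r' + 2) + (e + f) + u - (2 * (r' + 2) + (e + f)) = u := by omega
  have e3 : e + f - e + 2 = f + 2 := by omega
  have e4 : 2 * (r' + 2) + (e + f) + u - 1 = 2 * r' + 3 + (e + f) + u := by omega
  have e5 : 2 * (r' + 2) + (e + f) + u - (e + 2) = 2 * r' + 2 + f + u := by omega
  have e6 : r' + 2 - 1 = r' + 1 := by omega
  have e7 : r' + 2 - 2 = r' := by omega
  rw [e1, e2, e3, e4, e5, e6, e7]
  nlinarith

end C047

end TriangleCap

end PercRepro
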